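import Summits.AnomalousDissipation.AnomalousDissipation.Theorems.SawtoothPulseCascadeK1LocalisedCascadeKHSheetBlock
import Summits.AnomalousDissipation.AnomalousDissipation.Theorems.SawtoothPulseCascadeK1LocalisedCascadeKHSheetEnergy

/-!
# K2 lane (route-2 `SawtoothPulseCascade`, crux dir `K1LocalisedCascade`): the TRACE BOUND for the Kelvin–Helmholtz sheet block (S2, homogeneous part)

Helper file of the K2 lane (S2 `KHSheetAbsolute` / `KHSheetLyapunov` of planner p4's `K2ControlSketch.lean`; ACL item stmt-AnomalousDissipation-19491).
For the sheet block `X` of the line `k` with Bloch phase `β` (p4's `khField`, written out), its energy Gram `M = [[m, −S],[−S̄, m]]`, `m = −Σ₀`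
(p4's `khForm`), and any real `C, Sn` with `C² + Sn²·k²·c²(k,β) = 1` — which is exactly `det(C·Id + Sn·X) = 1`, satisfied by the three propagator
pairs `(cosh σθ, sinh σθ/σ)`, `(cos ωθ, sin ωθ/ω)`, `(1, θ)` of `sheet_solution_eq` — the propagated energy obeys

  `khForm(C v + Sn X v) ≤ 2τ · khForm v`,  `τ = C² + Sn² k² W(k,β)`,  `W = (A m + E |S|²)/(m² − |S|²)`,
  `A = m p² + 4|S|²(p + m)`, `E = p² + 4mp + 4|S|²`, `p = π/2 − 2m`      (`khForm_propagated_le_trace`).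

Here `2τ = tr(M⁻¹ PᴴMP)` for `P = C·Id + Sn·X`, and since `det P = 1` the two `M`-singular values of `P` are reciprocal, so `2τ = λ_max + 1/λ_max`:
the bound is sharp up to `+1/λ_max`. Mechanism (`sheetPencil_core`, pure real algebra): `2τM − PᴴMP = [[d, −ζS],[−ζ̄S̄, d]]` with
`d·(m²−|S|²) = C²m(m²−|S|²) + Sn²k²Q`, `Q = m³p² + 3mp²|S|² + 12m²p|S|² + 4p|S|⁴ + 4m³|S|² + 12m|S|⁴ ≥ 0`
(`4(m³+3m|S|²)Q = (2(m³+3m|S|²)p + 12m²|S|² + 4|S|⁴)² + 16|S|²(m²−|S|²)³`) and `det = d² − |ζ|²|S|² = m² − |S|² > 0` (given `det P = 1`).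
Consequence: `KHSheetAbsolute γ B ⟸ sup_{k,β,θ≤γ} 2τ ≤ B²` — an ODE-free two-variable table (memo `Cruxes/K1LocalisedCascade/K2SheetBlockPropagator.md`).
No definitions; no statement about the crux. [cite: Drazin2002, §8.3 (8.36)–(8.38) (Rayleigh jump conditions at the kinks of a broken-line profile)] [problem: turb]
-/

-- `Summit.<Summit>.<Problem>`: single-conjunct summit, the duplicate namespace segment is deliberate.
set_option linter.dupNamespace false

noncomputable section

namespace Summit.AnomalousDissipation.AnomalousDissipation.Theorems.SawtoothPulseCascade.K2PhaseBudget

open Set Real Complex Literature.Analysis.FluidPDE.SawtoothCascade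

/-! ## §1 The real-variable core: a 2×2 Hermitian pencil with unit determinant -/

/-- **Pencil core.** Real variables: `m > 0`, `0 ≤ t < m²` (`t = |S|²`), `n₀, n₁ ≥ 0` (`= |v₀|², |v₁|²`), `R² + J² = t n₀ n₁`
(`R + iJ = S v̄₀ v₁`), and the unit-determinant relation `C² + Sn²k²((π/2−2m)² − 4t) = 1`. Then the expanded propagated energy is at most
`2τ` times the energy, `τ = C² + Sn²k²(Am + Et)/(m² − t)`. [folklore] -/
theorem sheetPencil_core {m t k C Sn n₀ n₁ R J : ℝ} (hm : 0 < m) (ht0 : 0 ≤ t) (htm : t < m ^ 2)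
    (hdet : C ^ 2 + Sn ^ 2 * k ^ 2 * ((π / 2 - 2 * m) ^ 2 - 4 * t) = 1)
    (hn₀ : 0 ≤ n₀) (hn₁ : 0 ≤ n₁) (hRJ : R ^ 2 + J ^ 2 = t * (n₀ * n₁)) :
    C ^ 2 * (m * (n₀ + n₁) - 2 * R) + C * Sn * (2 * π * k) * J +
        Sn ^ 2 * k ^ 2 * ((m * (π / 2 - 2 * m) ^ 2 + 4 * t * ((π / 2 - 2 * m) + m)) * (n₀ + n₁) +
          2 * ((π / 2 - 2 * m) ^ 2 + 4 * m * (π / 2 - 2 * m) + 4 * t) * R) ≤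
      2 * (C ^ 2 + Sn ^ 2 * k ^ 2 * (((m * (π / 2 - 2 * m) ^ 2 + 4 * t * ((π / 2 - 2 * m) + m)) * m +
          ((π / 2 - 2 * m) ^ 2 + 4 * m * (π / 2 - 2 * m) + 4 * t) * t) / (m ^ 2 - t))) * (m * (n₀ + n₁) - 2 * R) := by
  set p := π / 2 - 2 * m with hp
  have hπ : π = 2 * p + 4 * m := by rw [hp]; ring
  set u := Sn ^ 2 * k ^ 2 with hu
  set A := m * p ^ 2 + 4 * t * (p + m) with hA
  set E := p ^ 2 + 4 * m * p + 4 * t with hE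
  set D₀ := m ^ 2 - t with hD₀
  have hD₀0 : 0 < D₀ := by rw [hD₀]; linarith
  have hD₀ne : D₀ ≠ 0 := hD₀0.ne'
  set N := n₀ + n₁ with hN
  have hN0 : 0 ≤ N := by rw [hN]; linarith
  have hu0 : 0 ≤ u := by rw [hu]; positivity
  -- `τ`, `d`, `x`, `y`
  set τ := C ^ 2 + u * ((A * m + E * t) / D₀) with hτ
  set d := 2 * τ * m - (C ^ 2 * m + u * A) with hd
  set x := 2 * τ - C ^ 2 + u * E with hx
  set y := π * k * C * Sn with hy
  -- the goal is `d N − 2(xR + yJ) ≥ 0`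
  have hgoal : 2 * τ * (m * N - 2 * R) -
      (C ^ 2 * (m * N - 2 * R) + C * Sn * (2 * π * k) * J + u * (A * N + 2 * E * R)) =
      d * N - 2 * (x * R + y * J) := by
    rw [hd, hx, hy, hu]; ring
  -- (f1) `d ≥ 0`
  set Q := m ^ 3 * p ^ 2 + 3 * m * p ^ 2 * t + 12 * m ^ 2 * p * t + 4 * p * t ^ 2 + 4 * m ^ 3 * t + 12 * m * t ^ 2 with hQ
  have hQ0 : 0 ≤ Q := by
    have h4 : 4 * (m ^ 3 + 3 * m * t) * Q =
        (2 * (m ^ 3 + 3 * m * t) * p + 12 * m ^ 2 * t + 4 * t ^ 2) ^ 2 + 16 * t * D₀ ^ 3 := by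
      rw [hQ, hD₀]; ring
    have hpos : 0 < 4 * (m ^ 3 + 3 * m * t) := by positivity
    have hrhs : 0 ≤ (2 * (m ^ 3 + 3 * m * t) * p + 12 * m ^ 2 * t + 4 * t ^ 2) ^ 2 + 16 * t * D₀ ^ 3 := by
      positivity
    rw [← h4] at hrhs
    exact (mul_nonneg_iff_of_pos_left hpos).mp hrhs
  have hdD : d * D₀ = C ^ 2 * m * D₀ + u * Q := by
    rw [hd, hτ]
    field_simp
    rw [hQ, hA, hE, hD₀]
    ring
  have hd0 : 0 ≤ d := by
    have h1 : 0 ≤ d * D₀ := by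
      rw [hdD]
      have : 0 ≤ C ^ 2 * m * D₀ := by positivity
      have : 0 ≤ u * Q := mul_nonneg hu0 hQ0
      linarith
    exact nonneg_of_mul_nonneg_left h1 hD₀0
  -- (f2) the determinant identity `d² − t(x² + y²) = D₀` (uses `det P = 1`)
  have hC2 : C ^ 2 = 1 - u * (p ^ 2 - 4 * t) := by rw [hu]; linarith
  have hxD : x * D₀ = C ^ 2 * D₀ + u * (2 * (A * m + E * t) + E * D₀) := by
    rw [hx, hτ]
    field_simp
    ring
  have hy2 : y ^ 2 = (2 * p + 4 * m) ^ 2 * u * C ^ 2 := by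
    rw [hy, hπ, hu]; ring
  have hdet' : (d * D₀) ^ 2 - t * ((x * D₀) ^ 2 + y ^ 2 * D₀ ^ 2) = D₀ ^ 3 := by
    rw [hdD, hxD, hy2, hC2, hQ, hA, hE, hD₀]
    ring
  have hdsq : d ^ 2 = t * (x ^ 2 + y ^ 2) + D₀ := by
    have h1 : (d * D₀) ^ 2 - t * ((x * D₀) ^ 2 + y ^ 2 * D₀ ^ 2) =
        (d ^ 2 - t * (x ^ 2 + y ^ 2)) * D₀ ^ 2 := by ring
    rw [h1] at hdet'
    have h2 : (d ^ 2 - t * (x ^ 2 + y ^ 2)) * D₀ ^ 2 = D₀ * D₀ ^ 2 := by rw [hdet']; ring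
    have h3 := mul_right_cancel₀ (pow_ne_zero 2 hD₀ne) h2
    linarith
  -- (f3) Cauchy–Schwarz and AM–GM: `(2(xR + yJ))² ≤ t(x²+y²)N² ≤ d²N²`
  have hCS : (x * R + y * J) ^ 2 ≤ (x ^ 2 + y ^ 2) * (R ^ 2 + J ^ 2) := by
    have e : (x ^ 2 + y ^ 2) * (R ^ 2 + J ^ 2) = (x * R + y * J) ^ 2 + (x * J - y * R) ^ 2 := by ring
    rw [e]; exact le_add_of_nonneg_right (sq_nonneg _)
  have hAG : 4 * (n₀ * n₁) ≤ N ^ 2 := by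
    have e : N ^ 2 = 4 * (n₀ * n₁) + (n₀ - n₁) ^ 2 := by rw [hN]; ring
    rw [e]; exact le_add_of_nonneg_right (sq_nonneg _)
  have hsq : (2 * (x * R + y * J)) ^ 2 ≤ (d * N) ^ 2 := by
    have h1 : (2 * (x * R + y * J)) ^ 2 ≤ 4 * ((x ^ 2 + y ^ 2) * (t * (n₀ * n₁))) := by
      rw [← hRJ]; linarith
    have hxy : 0 ≤ (x ^ 2 + y ^ 2) * t := by positivity
    have h2 : 4 * ((x ^ 2 + y ^ 2) * (t * (n₀ * n₁))) ≤ (x ^ 2 + y ^ 2) * t * N ^ 2 := by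
      have := mul_le_mul_of_nonneg_left hAG hxy
      linarith
    have h3 : (x ^ 2 + y ^ 2) * t * N ^ 2 ≤ d ^ 2 * N ^ 2 := by
      have : (x ^ 2 + y ^ 2) * t ≤ d ^ 2 := by rw [hdsq]; linarith
      exact mul_le_mul_of_nonneg_right this (sq_nonneg N)
    calc (2 * (x * R + y * J)) ^ 2 ≤ 4 * ((x ^ 2 + y ^ 2) * (t * (n₀ * n₁))) := h1
      _ ≤ (x ^ 2 + y ^ 2) * t * N ^ 2 := h2
      _ ≤ d ^ 2 * N ^ 2 := h3
      _ = (d * N) ^ 2 := by ring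
  have hfin : 2 * (x * R + y * J) ≤ d * N := by
    have hdN : 0 ≤ d * N := mul_nonneg hd0 hN0
    exact abs_le_of_sq_le_sq' hsq hdN |>.2
  -- assemble
  have : 0 ≤ 2 * τ * (m * N - 2 * R) -
      (C ^ 2 * (m * N - 2 * R) + C * Sn * (2 * π * k) * J + u * (A * N + 2 * E * R)) := by
    rw [hgoal]; linarith
  linarith

/-! ## §2 The trace bound for the sheet block -/

/-- **Trace bound (S2, homogeneous sheet block).** For `k > 0`, `m = −Σ₀(k,β)`, `S = S_β(k)`, `p = π/2 + 2Σ₀`, the block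
`X v = ik(−p v₀ − 2S v₁, 2S̄ v₀ + p v₁)` and real `C, Sn` with `C² + Sn²k²c²(k,β) = 1` (e.g. the propagator pairs of `sheet_solution_eq`):
`khForm(C v + Sn X v) ≤ 2τ·khForm v` with `τ = C² + Sn²k²(Am + E|S|²)/(m² − |S|²)`, `A = m p² + 4|S|²(p+m)`, `E = p² + 4mp + 4|S|²`
(`2τ = λ_max + 1/λ_max` of the Gram pencil). [cite: Drazin2002, §8.3 (8.36)–(8.38)] -/
theorem khForm_propagated_le_trace {k : ℝ} (hk : 0 < k) (β : ℝ) {p S : ℂ} {m : ℝ}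
    (hp : p = ((π / 2 + 2 * sawSigma0 k β : ℝ) : ℂ)) (hS : S = sawS k β) (hm : m = -sawSigma0 k β)
    (C Sn : ℝ) (hdet : C ^ 2 + Sn ^ 2 * k ^ 2 * sawC2 k β = 1) (v₀ v₁ : ℂ) :
    m * (Complex.normSq ((C : ℂ) * v₀ + (Sn : ℂ) * (I * k * (-p * v₀ - 2 * S * v₁))) +
          Complex.normSq ((C : ℂ) * v₁ + (Sn : ℂ) * (I * k * (2 * (starRingEnd ℂ) S * v₀ + p * v₁)))) -
        2 * ((starRingEnd ℂ) ((C : ℂ) * v₀ + (Sn : ℂ) * (I * k * (-p * v₀ - 2 * S * v₁))) * S *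
          ((C : ℂ) * v₁ + (Sn : ℂ) * (I * k * (2 * (starRingEnd ℂ) S * v₀ + p * v₁)))).re ≤
      2 * (C ^ 2 + Sn ^ 2 * k ^ 2 *
          (((m * (π / 2 - 2 * m) ^ 2 + 4 * Complex.normSq S * ((π / 2 - 2 * m) + m)) * m +
            ((π / 2 - 2 * m) ^ 2 + 4 * m * (π / 2 - 2 * m) + 4 * Complex.normSq S) * Complex.normSq S) /
            (m ^ 2 - Complex.normSq S))) *
        (m * (Complex.normSq v₀ + Complex.normSq v₁) - 2 * ((starRingEnd ℂ) v₀ * S * v₁).re) := by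
  rw [khForm_propagator_expand k β hp hm C Sn v₀ v₁]
  have hm0 : 0 < m := by rw [hm]; linarith [sawSigma0_neg hk β]
  have htm : Complex.normSq S < m ^ 2 := by
    rw [hS, hm, neg_sq]; exact normSq_sawS_lt_sq_sawSigma0 hk β
  have ht0 : 0 ≤ Complex.normSq S := Complex.normSq_nonneg _
  have hc2 : sawC2 k β = (π / 2 - 2 * m) ^ 2 - 4 * Complex.normSq S := by
    unfold sawC2; rw [hm, ← hS]; ring
  rw [hc2] at hdet
  have hcomm : (starRingEnd ℂ) v₀ * S * v₁ = S * (starRingEnd ℂ) v₀ * v₁ := by ring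
  rw [hcomm]
  set Z := S * (starRingEnd ℂ) v₀ * v₁ with hZ
  have hRJ : Z.re ^ 2 + Z.im ^ 2 = Complex.normSq S * (Complex.normSq v₀ * Complex.normSq v₁) := by
    have h1 : Z.re ^ 2 + Z.im ^ 2 = Complex.normSq Z := by rw [Complex.normSq_apply]; ring
    rw [h1, hZ, Complex.normSq_mul, Complex.normSq_mul, Complex.normSq_conj]
    ring
  exact sheetPencil_core hm0 ht0 htm hdet (Complex.normSq_nonneg _) (Complex.normSq_nonneg _) hRJ

end Summit.AnomalousDissipation.AnomalousDissipation.Theorems.SawtoothPulseCascade.K2PhaseBudget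

end
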